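import Summits.QuantumFields.BalabanUV.T4Continuum.Support.SmoothRefineSlices
import Summits.QuantumFields.BalabanUV.T4Continuum.Support.SmoothRefineWhitney
import HarnessLib

/-!
# T⁴ programme, node NE3 — the kinematic refinement lemma, abelian line, file 5: THE CONTOUR AVERAGE `T_c` OF A FINE
# COCHAIN, ITS NEUTRALISATION BY A SLICE LIFT, AND ITS COBOUNDARY (`SmoothRefineNeutral`)

Cell `pub-balaban`, NE3 formalisation swarm (`t4/formal/NE3/LEAVES.md` row S4b, unit
`b2b-balaban-t4-ne3-formalise-leaf-10`); sequel of `SmoothRefineSlices` and `SmoothRefineWhitney`.  LATTICE BOOKKEEPING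
for cochains with values in a normed `ℂ`-algebra `𝔸` (nothing abelian about configurations yet, no estimate of the
programme).  The tree's `B7Prop1Explicit.Tside L A q κ = Σ_{x ∈ B(c₋)} L^{−d} A(Γ_{c,x})` ([Balaban1985Averaging] (47)–(48)
p. 25: the linearisation of the block average (42)) is the functional by which, in the abelian case, the average of
`exp ∘ A` is EXACTLY `exp (T_c(A))` (row S4b-i, `AbelianBlockAverage.bavg_expUnit`).  Here:

§1 linearity of the tree's contour sum `asum` and of `Tside`, and the size bound `‖T_c(A)‖ ≤ (2dL + L)·a`;
§2 `Tside` of a SLICE LIFT is the lifted cochain: `Tside L (sliceLift L ψ) (L•z) κ = ψ z κ` (every contour `Γ_{c,x}` of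
the coarse bond `c = (z, κ)` crosses that bond's last slice exactly once, `SmoothRefineSlices.asum_sliceLift_gammaWord`);
hence THE NEUTRALISATION `neutralize L c := c − sliceLift L (T(c))` has `Tside L (neutralize L c) (L•z) κ = 0` for every
coarse bond — the device that makes the abelian refinement EXACT with no fixed point and no pre-compensation;
§3 the coboundary of a slice lift is the corner pullback of the coarse coboundary (`dC_sliceLift`), and THE COBOUNDARY OF
THE CONTOUR AVERAGE IS THE BLOCK AVERAGE OF THE TRANSLATED-SQUARE CIRCULATIONS:
`dC (z ↦ T(c)(L•z)) (z;μν) = Σ_r L^{−d} Σ_{i,j<L} dC c (L•z + r + i e_μ + j e_ν; μν)` — the tree's `corner_cancellation` +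
`stokes` (B7 (48)) read for the coarse plaquette of the contour averages.

HONEST FRAMING: finite-`T⁴` kinematics of block averaging (rung (B)+1 — NOT infinite volume, NOT a mass gap, NOT Clay); no
estimate of the programme, nothing of NE3 claimed; no `BetaPertH`, no (B), no G-an2-4; no printed sentence is a
hypothesis.  PLACEMENT (human rule 2026-08-19): our work, under `Summits/QuantumFields/BalabanUV/`.
-/

set_option autoImplicit false

open scoped BigOperators

namespace Summit.QuantumFields.BalabanUV.T4Continuum.SmoothRefineNeutral

open Literature.MathematicalPhysics.QuantumFieldTheory.Balaban1983to89
open B7Prop1Explicit SmoothRefineBlocks SmoothRefineSlices SmoothRefineInterp SmoothRefineWhitney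

noncomputable section

variable {d : ℕ}


/-! ## §1 Linearity and size of the contour sum and of the contour average -/

section Linear

variable {𝔸 : Type*} [NormedRing 𝔸]

/-- `A ↦ A(Γ)` is additive: subtraction. [folklore] -/
theorem asum_sub (A B : Site d → Fin d → 𝔸) :
    ∀ (x : Site d) (w : List (Letter d)), asum (fun y μ => A y μ - B y μ) x w = asum A x w - asum B x w
  | x, [] => by simp
  | x, l :: w => by
    rw [asum_cons, asum_cons, asum_cons, asum_sub A B (x + l.vec) w]
    obtain ⟨μ, b⟩ := l
    cases b <;> simp only [stepA, Bool.false_eq_true, ↓reduceIte] <;> abel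

/-- `asum c p (plaqWord μ ν)` is the coboundary `dC c p μ ν`. [folklore] -/
theorem asum_plaqWord_eq_dC (c : Site d → Fin d → 𝔸) (p : Site d) (μ ν : Fin d) :
    asum c p (plaqWord μ ν) = dC c p μ ν := by
  rw [asum_plaqWord]; rfl

/-- `‖A(Γ)‖ ≤ |Γ|·a` from a GLOBAL bond bound `‖A_b‖ ≤ a`. [folklore] -/
theorem norm_asum_le_length (A : Site d → Fin d → 𝔸) {a : ℝ} (hA : ∀ y μ, ‖A y μ‖ ≤ a) :
    ∀ (x : Site d) (w : List (Letter d)), ‖asum A x w‖ ≤ w.length * a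
  | x, [] => by simp
  | x, l :: w => by
    rw [asum_cons, List.length_cons, Nat.cast_succ, add_mul, one_mul]
    have hl : ‖stepA A x l‖ ≤ a := by
      obtain ⟨μ, b⟩ := l
      cases b
      · rw [stepA_false, norm_neg]; exact hA _ _
      · rw [stepA_true]; exact hA _ _
    exact (norm_add_le _ _).trans (by linarith [norm_asum_le_length A hA (x + l.vec) w])

/-- MEMBERSHIP: the contour sum of a cochain with values in an additive subgroup lies in it. [folklore] -/
theorem asum_mem (K : AddSubgroup 𝔸) {A : Site d → Fin d → 𝔸} (hA : ∀ y μ, A y μ ∈ K) :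
    ∀ (x : Site d) (w : List (Letter d)), asum A x w ∈ K
  | x, [] => by simp [K.zero_mem]
  | x, l :: w => by
    rw [asum_cons]
    refine K.add_mem ?_ (asum_mem K hA (x + l.vec) w)
    obtain ⟨μ, b⟩ := l
    cases b
    · rw [stepA_false]; exact K.neg_mem (hA _ _)
    · rw [stepA_true]; exact hA _ _

end Linear

section Tside

variable {𝔸 : Type*} [NormedRing 𝔸] [NormedAlgebra ℂ 𝔸]

/-- `Tside` is additive: subtraction. [folklore] -/
theorem Tside_sub (L : ℕ) (A B : Site d → Fin d → 𝔸) (q : Site d) (κ : Fin d) :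
    Tside L (fun y μ => A y μ - B y μ) q κ = Tside L A q κ - Tside L B q κ := by
  simp only [Tside, asum_sub, smul_sub, Finset.sum_sub_distrib]

/-- **Size of the contour average**: `‖T_c(A)‖ ≤ (2dL + L)·a` from `‖A_b‖ ≤ a` (every contour `Γ_{c,x}` has at most
`2d(L−1) + L ≤ 2dL + L` bonds; the weights of (42) are a probability vector). [folklore] -/
theorem norm_Tside_le {L : ℕ} (hL : 1 ≤ L) (A : Site d → Fin d → 𝔸) {a : ℝ} (ha : 0 ≤ a) (hA : ∀ y μ, ‖A y μ‖ ≤ a)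
    (q : Site d) (κ : Fin d) : ‖Tside L A q κ‖ ≤ (2 * (d * L) + L) * a := by
  unfold Tside
  refine norm_avg_le L hL _ fun r => ?_
  refine (norm_asum_le_length A hA q _).trans ?_
  rw [length_gammaWord]
  have h1 := l1_boxVec_le L r
  have h2 : ((2 * l1 (boxVec L r) + L : ℕ) : ℝ) ≤ 2 * (d * L) + L := by exact_mod_cast (by omega)
  exact mul_le_mul_of_nonneg_right h2 ha

/-! ## §2 The contour average of a slice lift; neutralisation -/

/-- **The contour average of a slice lift is the lifted cochain**: `Tside L (sliceLift L ψ) (L • z) κ = ψ z κ`.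
[folklore] -/
theorem Tside_sliceLift {L : ℕ} (hL : 1 ≤ L) (ψ : Site d → Fin d → 𝔸) (z : Site d) (κ : Fin d) :
    Tside L (sliceLift L ψ) ((L : ℤ) • z) κ = ψ z κ := by
  unfold Tside
  simp_rw [asum_sliceLift_gammaWord hL]
  rw [← Finset.sum_smul, sum_weights L hL, one_smul]

/-- The contour averages of a fine cochain, read as a COARSE cochain: `T(c)(z, κ) := Tside L c (L • z) κ`. [folklore] -/
def Tcoarse (L : ℕ) (c : Site d → Fin d → 𝔸) : Site d → Fin d → 𝔸 := fun z κ => Tside L c ((L : ℤ) • z) κ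

/-- THE NEUTRALISATION of a fine cochain: subtract the slice lift of its contour averages. [folklore] -/
def neutralize (L : ℕ) (c : Site d → Fin d → 𝔸) : Site d → Fin d → 𝔸 :=
  fun y ν => c y ν - sliceLift L (Tcoarse L c) y ν

/-- **A neutralised cochain has vanishing contour averages on every coarse bond.** [folklore] -/
theorem Tside_neutralize {L : ℕ} (hL : 1 ≤ L) (c : Site d → Fin d → 𝔸) (z : Site d) (κ : Fin d) :
    Tside L (neutralize L c) ((L : ℤ) • z) κ = 0 := by
  unfold neutralize
  rw [Tside_sub, Tside_sliceLift hL, Tcoarse, sub_self]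

/-- Size of the neutralised cochain: `‖c′_b‖ ≤ (1 + 2dL + L)·a` from `‖c_b‖ ≤ a`. [folklore] -/
theorem norm_neutralize_le {L : ℕ} (hL : 1 ≤ L) (c : Site d → Fin d → 𝔸) {a : ℝ} (ha : 0 ≤ a)
    (hc : ∀ y μ, ‖c y μ‖ ≤ a) (y : Site d) (ν : Fin d) : ‖neutralize L c y ν‖ ≤ (1 + (2 * (d * L) + L)) * a := by
  unfold neutralize
  refine (norm_sub_le _ _).trans ?_
  rw [add_mul, one_mul]
  refine add_le_add (hc y ν) ?_
  unfold sliceLift Tcoarse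
  split_ifs
  · exact norm_Tside_le hL c ha hc _ _
  · rw [norm_zero]; positivity

/-- Periodicity of `Tside` under coarse translations of a periodic cochain. [folklore] -/
theorem Tside_add_period (L : ℕ) (c : Site d → Fin d → 𝔸) {P : ℤ}
    (hc : ∀ (y : Site d) (κ μ : Fin d), c (y + P • e κ) μ = c y μ) (q : Site d) (κ τ : Fin d) :
    Tside L c (q + P • e τ) κ = Tside L c q κ := by
  unfold Tside
  refine Finset.sum_congr rfl fun r _ => ?_
  congr 1
  -- translate the whole contour
  suffices h : ∀ (w : List (Letter d)) (x : Site d), asum c (x + P • e τ) w = asum c x w from h _ q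
  intro w
  induction w with
  | nil => intro x; simp
  | cons l w ih =>
    intro x
    rw [asum_cons, asum_cons, add_right_comm, ih]
    congr 1
    obtain ⟨μ, b⟩ := l
    cases b
    · simp only [stepA, Bool.false_eq_true, ↓reduceIte, Letter.vec_false]
      rw [show x + P • e τ + -e μ = (x + -e μ) + P • e τ by abel, hc]
    · simp only [stepA, ↓reduceIte, hc]

/-- MEMBERSHIP of the contour average in a real-stable additive subgroup. [folklore] -/
theorem Tside_mem (K : AddSubgroup 𝔸) (hK : ∀ (r : ℝ) (x : 𝔸), x ∈ K → r • x ∈ K) (L : ℕ) {A : Site d → Fin d → 𝔸}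
    (hA : ∀ y μ, A y μ ∈ K) (q : Site d) (κ : Fin d) : Tside L A q κ ∈ K := by
  unfold Tside
  exact Finset.sum_induction _ (fun x => x ∈ K) (fun a b ha hb => K.add_mem ha hb) K.zero_mem
    (fun r _ => hK _ _ (asum_mem K hA _ _))

omit [NormedAlgebra ℂ 𝔸] in
/-- MEMBERSHIP of a slice lift. [folklore] -/
theorem sliceLift_mem (K : AddSubgroup 𝔸) (L : ℕ) {ψ : Site d → Fin d → 𝔸} (hψ : ∀ z μ, ψ z μ ∈ K) (y : Site d)
    (μ : Fin d) : sliceLift L ψ y μ ∈ K := by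
  unfold sliceLift; split_ifs; exacts [hψ _ _, K.zero_mem]

/-- MEMBERSHIP of the neutralised cochain. [folklore] -/
theorem neutralize_mem (K : AddSubgroup 𝔸) (hK : ∀ (r : ℝ) (x : 𝔸), x ∈ K → r • x ∈ K) (L : ℕ)
    {c : Site d → Fin d → 𝔸} (hc : ∀ y μ, c y μ ∈ K) (y : Site d) (ν : Fin d) : neutralize L c y ν ∈ K :=
  K.sub_mem (hc y ν) (sliceLift_mem K L (fun _ κ => Tside_mem K hK L hc _ κ) y ν)

end Tside

/-! ## §2b Periodicity under coarse translations -/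

section Periodicity

variable {X : Type*} [AddCommGroup X] [Module ℝ X]

/-- PERIODICITY: a coarse translation by `P` blocks of a `P`-periodic `G` does not change the interpolation. [folklore] -/
theorem interp_add_period {L : ℕ} (hL : 1 ≤ L) (S : Finset (Fin d)) {G : Site d → X} {P : ℤ}
    (hG : ∀ (z : Site d) (κ : Fin d), G (z + P • e κ) = G z) (y : Site d) (κ : Fin d) :
    interp L S G (y + ((L : ℤ) * P) • e κ) = interp L S G y := by
  obtain ⟨hb, hr⟩ := blk_res_add_period hL y P κ
  have hw : wt L (y + ((L : ℤ) * P) • e κ) = wt L y := by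
    funext i; simp only [wt, hr]
  unfold interp
  rw [hw, hb, interpCore_shift]
  simp only [hG]

/-- PERIODICITY of the difference coefficient. [folklore] -/
theorem dcoef_add_period {L : ℕ} (hL : 1 ≤ L) (S : Finset (Fin d)) (y : Site d) (P : ℤ) (κ α : Fin d) :
    dcoef L S (y + ((L : ℤ) * P) • e κ) α = dcoef L S y α := by
  simp only [dcoef, (blk_res_add_period hL y P κ).2]

/-- PERIODICITY of the weights. [folklore] -/
theorem wt_add_period {L : ℕ} (hL : 1 ≤ L) (y : Site d) (P : ℤ) (κ α : Fin d) :
    wt L (y + ((L : ℤ) * P) • e κ) α = wt L y α := by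
  simp only [wt, (blk_res_add_period hL y P κ).2]

/-- PERIODICITY of a step potential for a `P`-periodic coarse cochain. [folklore] -/
theorem cStep_add_period {L : ℕ} (hL : 1 ≤ L) (k : Fin d) {F : Site d → Fin d → Fin d → X} {P : ℤ}
    (hF : ∀ (z : Site d) (κ μ ν : Fin d), F (z + P • e κ) μ ν = F z μ ν) (y : Site d) (κ ν : Fin d) :
    cStep L k F (y + ((L : ℤ) * P) • e κ) ν = cStep L k F y ν := by
  unfold cStep
  rw [wt_add_period hL, dcoef_add_period hL, interp_add_period hL _ (fun z κ' => hF z κ' k ν)]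

/-- PERIODICITY of the Whitney potential. [folklore] -/
theorem whitneyPot_add_period {L : ℕ} (hL : 1 ≤ L) {F : Site d → Fin d → Fin d → X} {P : ℤ}
    (hF : ∀ (z : Site d) (κ μ ν : Fin d), F (z + P • e κ) μ ν = F z μ ν) (y : Site d) (κ ν : Fin d) :
    whitneyPot L F (y + ((L : ℤ) * P) • e κ) ν = whitneyPot L F y ν := by
  unfold whitneyPot
  exact Finset.sum_congr rfl fun k _ => cStep_add_period hL k hF y κ ν

end Periodicity

section TsidePeriodic

variable {𝔸 : Type*} [NormedRing 𝔸] [NormedAlgebra ℂ 𝔸]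

/-- PERIODICITY of the coarse contour averages of a fine cochain with period `L·P`. [folklore] -/
theorem Tcoarse_add_period (L : ℕ) (c : Site d → Fin d → 𝔸) {P : ℤ}
    (hc : ∀ (y : Site d) (κ μ : Fin d), c (y + ((L : ℤ) * P) • e κ) μ = c y μ) (z : Site d) (κ τ : Fin d) :
    Tcoarse L c (z + P • e τ) κ = Tcoarse L c z κ := by
  unfold Tcoarse
  rw [smul_add, smul_smul, Tside_add_period L c hc]

/-- PERIODICITY of the neutralised cochain. [folklore] -/
theorem neutralize_add_period {L : ℕ} (hL : 1 ≤ L) (c : Site d → Fin d → 𝔸) {P : ℤ}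
    (hc : ∀ (y : Site d) (κ μ : Fin d), c (y + ((L : ℤ) * P) • e κ) μ = c y μ) (y : Site d) (κ ν : Fin d) :
    neutralize L c (y + ((L : ℤ) * P) • e κ) ν = neutralize L c y ν := by
  unfold neutralize
  rw [hc, sliceLift_add_period hL _ (fun z τ μ => Tcoarse_add_period L c hc z μ τ)]

end TsidePeriodic

/-! ## §3 Coboundaries: of a slice lift, and of the contour averages -/

section Coboundary

variable {𝔸 : Type*} [NormedRing 𝔸] [NormedAlgebra ℂ 𝔸]

omit [NormedAlgebra ℂ 𝔸] in
/-- **The coboundary of a slice lift is the corner pullback of the coarse coboundary** (`μ ≠ ν`). [folklore] -/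
theorem dC_sliceLift {L : ℕ} (hL : 1 ≤ L) (ψ : Site d → Fin d → 𝔸) (y : Site d) {μ ν : Fin d} (hμν : μ ≠ ν) :
    dC (sliceLift L ψ) y μ ν = cornerPull L (fun z μ ν => dC ψ z μ ν) y μ ν := by
  rw [← asum_plaqWord_eq_dC, asum_sliceLift_plaqWord hL ψ y hμν, cornerPull, asum_plaqWord_eq_dC]

/-- **THE COBOUNDARY OF THE CONTOUR AVERAGES IS THE BLOCK AVERAGE OF THE TRANSLATED-SQUARE CIRCULATIONS** (B7 (48):
`corner_cancellation` + `stokes`): `dC (T(c)) (z; μ, ν) = Σ_r L^{−d} Σ_{i<L} Σ_{j<L} dC c (L•z + r + i e_μ + j e_ν; μ, ν)`.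
[folklore] -/
theorem dC_Tcoarse (L : ℕ) (c : Site d → Fin d → 𝔸) (z : Site d) (μ ν : Fin d) :
    dC (Tcoarse L c) z μ ν = ∑ r : Fin d → Fin L, ((L : ℝ) ^ d)⁻¹ •
      ∑ i ∈ Finset.range L, ∑ j ∈ Finset.range L,
        dC c ((L : ℤ) • z + boxVec L r + (i : ℤ) • e μ + (j : ℤ) • e ν) μ ν := by
  have e1 : ((L : ℤ) • (z + e μ) : Site d) = (L : ℤ) • z + (L : ℤ) • e μ := smul_add _ _ _
  have e2 : ((L : ℤ) • (z + e ν) : Site d) = (L : ℤ) • z + (L : ℤ) • e ν := smul_add _ _ _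
  show Tcoarse L c z μ + Tcoarse L c (z + e μ) ν - Tcoarse L c (z + e ν) μ - Tcoarse L c z ν = _
  simp only [Tcoarse, Tside, e1, e2]
  rw [← Finset.sum_add_distrib, ← Finset.sum_sub_distrib, ← Finset.sum_sub_distrib]
  refine Finset.sum_congr rfl fun r _ => ?_
  rw [← smul_add, ← smul_sub, ← smul_sub, corner_cancellation, stokes]
  simp only [asum_plaqWord_eq_dC]

end Coboundary

end

end Summit.QuantumFields.BalabanUV.T4Continuum.SmoothRefineNeutral
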